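import Summits.Ventures.HodgeRepro2.T5SU11ReductionOfOrder

/-!
# The decaying solution at infinity: `χ(t) = φ(t) · ∫_t^∞ ds/(sinh 2s · φ(s)²)`

Row 443 (`T5SU11ReductionOfOrder`) built the second solution `v = φ · I`, `I(t) = ∫_1^t g`, `g = 1/(sinh 2s · φ²)`,
of the radial equation `sinh 2t · u″ + 2 cosh 2t · u′ = μ sinh 2t · u` on `(0, ∞)` from a positive solution `φ`.
When the integrand is INTEGRABLE AT INFINITY (`IntegrableOn g (Ioi 1)` — the case of a solution `φ` growing at
least like `e^{(μ'+1) t}`, `μ' > 0`), the tail integral `T(t) = ∫_t^∞ g` (`tailIntegral`) is finite for every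
`t > 0` (`integrableOn_roIntegrand_Ioi`), equals `J − I(t)` with `J = ∫_1^∞ g` (`tailIntegral_eq`), is positive
(`tailIntegral_pos`), and tends to `0` at infinity (`tendsto_tailIntegral_atTop`). Hence

  **`χ(t) := φ(t) · T(t) = J φ(t) − v(t)`**  (`decaySolution`, `decaySolution_eq`)

is a solution (`decaySolution_ode`) with `sinh 2t · (φ χ′ − φ′ χ) = −1` (`wronskian_decaySolution`), positive on
`(0, ∞)` (`decaySolution_pos`), and **`χ/φ → 0` at infinity** (`tendsto_decaySolution_div_atTop`): it is THE
solution decaying relative to `φ`, and it is unique with that property — **a solution `u` with `u/φ → 0` at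
infinity is a constant multiple of `χ`** (`eq_const_mul_decaySolution_of_tendsto`), the constant being
`−sinh 2 · (φ(1) u′(1) − φ′(1) u(1))`. Nothing is claimed about (N).

Blind lane: Mathlib + the HodgeRepro2 prefix only; no sorry; axioms ⊆ {propext, Classical.choice,
Quot.sound}.
-/

namespace Summit.Ventures.HodgeRepro2.T5SU11ReductionOfOrderInfinity

open Filter Topology MeasureTheory intervalIntegral
open Set (Ioi Ioo Icc Ioc uIcc)
open T5SU11ReductionOfOrder

/-- **The tail integral** `T(t) = ∫_t^∞ ds/(sinh 2s · φ(s)²)`. -/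
noncomputable def tailIntegral (φ : ℝ → ℝ) (t : ℝ) : ℝ := ∫ s in Ioi t, roIntegrand φ s

/-- **The decaying solution** `χ(t) = φ(t) · ∫_t^∞ ds/(sinh 2s · φ(s)²)`. -/
noncomputable def decaySolution (φ : ℝ → ℝ) (t : ℝ) : ℝ := φ t * tailIntegral φ t

section

variable {μ : ℝ} {φ φ' φ'' : ℝ → ℝ}
  (hφ : ∀ t, 0 < t → HasDerivAt φ (φ' t) t) (hφ' : ∀ t, 0 < t → HasDerivAt φ' (φ'' t) t)
  (hpos : ∀ t, 0 < t → 0 < φ t) (hint : IntegrableOn (roIntegrand φ) (Ioi 1))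

/-! ### Integrability of the tail -/

include hφ hpos in
/-- `g` is integrable on `(t, T]` for `t > 0`. -/
theorem integrableOn_roIntegrand_Ioc {t T : ℝ} (ht : 0 < t) :
    IntegrableOn (roIntegrand φ) (Ioc t T) := by
  refine ((continuousOn_roIntegrand hφ hpos).mono ?_).integrableOn_Icc.mono_set Set.Ioc_subset_Icc_self
  intro x hx
  exact lt_of_lt_of_le ht hx.1

include hφ hpos hint in
/-- **`g` is integrable on `(t, ∞)` for every `t > 0`.** -/
theorem integrableOn_roIntegrand_Ioi {t : ℝ} (ht : 0 < t) : IntegrableOn (roIntegrand φ) (Ioi t) := by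
  have h1 : IntegrableOn (roIntegrand φ) (Ioc t (max t 1)) :=
    integrableOn_roIntegrand_Ioc hφ hpos ht
  have h2 : IntegrableOn (roIntegrand φ) (Ioi (max t 1)) :=
    hint.mono_set (Set.Ioi_subset_Ioi (le_max_right _ _))
  have := h1.union h2
  rwa [Set.Ioc_union_Ioi_eq_Ioi (le_max_left _ _)] at this

include hφ hpos hint in
/-- **`T(t) = J − I(t)`** for `t > 0`, `J = ∫_1^∞ g`: the tail is the total minus the reduction-of-order integral. -/
theorem tailIntegral_eq {t : ℝ} (ht : 0 < t) :
    tailIntegral φ t = (∫ s in Ioi 1, roIntegrand φ s) - roIntegral φ t := by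
  unfold tailIntegral roIntegral
  rcases le_or_gt 1 t with h1t | ht1
  · -- `(1, ∞) = (1, t] ∪ (t, ∞)`
    have hu := setIntegral_union (f := roIntegrand φ) (μ := volume) (Set.Ioc_disjoint_Ioi_same (a := 1) (b := t))
      measurableSet_Ioi (integrableOn_roIntegrand_Ioc hφ hpos one_pos)
      (integrableOn_roIntegrand_Ioi hφ hpos hint ht)
    rw [Set.Ioc_union_Ioi_eq_Ioi h1t] at hu
    rw [hu, integral_of_le h1t]
    ring
  · -- `(t, ∞) = (t, 1] ∪ (1, ∞)`
    have hu := setIntegral_union (f := roIntegrand φ) (μ := volume) (Set.Ioc_disjoint_Ioi_same (a := t) (b := 1))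
      measurableSet_Ioi (integrableOn_roIntegrand_Ioc hφ hpos ht) hint
    rw [Set.Ioc_union_Ioi_eq_Ioi ht1.le] at hu
    rw [hu, integral_symm, integral_of_le ht1.le]
    ring

include hφ hpos hint in
/-- **`χ = J φ − v`** on `(0, ∞)`. -/
theorem decaySolution_eq {t : ℝ} (ht : 0 < t) :
    decaySolution φ t = (∫ s in Ioi 1, roIntegrand φ s) * φ t - secondSolution φ t := by
  unfold decaySolution secondSolution
  rw [tailIntegral_eq hφ hpos hint ht]
  ring

/-! ### Positivity and decay of the tail -/

include hφ hpos hint in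
/-- **`T(t) > 0`** for `t > 0`. -/
theorem tailIntegral_pos {t : ℝ} (ht : 0 < t) : 0 < tailIntegral φ t := by
  have hg : ∀ s, 0 < s → 0 < roIntegrand φ s := fun s hs => by
    unfold roIntegrand
    exact div_pos one_pos (mul_pos (sinh_two_mul_pos hs) (pow_pos (hpos s hs) 2))
  -- `∫_t^{t+1} g > 0` and `∫_t^{t+1} g ≤ ∫_t^∞ g`
  have h1 : 0 < ∫ s in t..(t + 1), roIntegrand φ s := by
    refine intervalIntegral_pos_of_pos_on ?_ (fun x hx => hg x (by linarith [hx.1])) (by linarith)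
    exact (intervalIntegrable_iff_integrableOn_Ioc_of_le (by linarith)).mpr
      (integrableOn_roIntegrand_Ioc hφ hpos ht)
  have h2 : ∫ s in t..(t + 1), roIntegrand φ s ≤ tailIntegral φ t := by
    unfold tailIntegral
    rw [integral_of_le (by linarith)]
    refine setIntegral_mono_set (integrableOn_roIntegrand_Ioi hφ hpos hint ht) ?_ ?_
    · exact ae_restrict_of_forall_mem measurableSet_Ioi (fun x hx => (hg x (lt_trans ht hx)).le)
    · exact (Set.Ioc_subset_Ioi_self).eventuallyLE
  linarith

include hφ hpos hint in
/-- **`χ > 0`** on `(0, ∞)`. -/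
theorem decaySolution_pos {t : ℝ} (ht : 0 < t) : 0 < decaySolution φ t :=
  mul_pos (hpos t ht) (tailIntegral_pos hφ hpos hint ht)

include hint in
/-- **`I(t) → J` as `t → ∞`.** -/
theorem tendsto_roIntegral_atTop :
    Tendsto (roIntegral φ) atTop (𝓝 (∫ s in Ioi 1, roIntegrand φ s)) :=
  intervalIntegral_tendsto_integral_Ioi 1 hint tendsto_id

include hφ hpos hint in
/-- **`T(t) → 0` as `t → ∞`.** -/
theorem tendsto_tailIntegral_atTop : Tendsto (tailIntegral φ) atTop (𝓝 0) := by
  have h := (tendsto_const_nhds (x := ∫ s in Ioi 1, roIntegrand φ s)).sub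
    (tendsto_roIntegral_atTop hint)
  rw [sub_self] at h
  refine h.congr' ?_
  filter_upwards [eventually_gt_atTop 0] with t ht
  exact (tailIntegral_eq hφ hpos hint ht).symm

include hφ hpos hint in
/-- **`χ/φ → 0` as `t → ∞`**: `χ` decays relative to `φ`. -/
theorem tendsto_decaySolution_div_atTop : Tendsto (fun t => decaySolution φ t / φ t) atTop (𝓝 0) := by
  refine (tendsto_tailIntegral_atTop hφ hpos hint).congr' ?_
  filter_upwards [eventually_gt_atTop 0] with t ht
  unfold decaySolution
  rw [mul_div_cancel_left₀ _ (hpos t ht).ne']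

/-! ### `χ` solves the equation; the Wronskian -/

/-- `χ′`, the derivative of `χ` on `(0, ∞)` (as `J φ′ − v′`). -/
noncomputable def decaySolution' (φ φ' : ℝ → ℝ) (t : ℝ) : ℝ :=
  (∫ s in Ioi 1, roIntegrand φ s) * φ' t - secondSolution' φ φ' t

/-- `χ″`, the second derivative of `χ` on `(0, ∞)` (as `J φ″ − v″`). -/
noncomputable def decaySolution'' (φ φ' φ'' : ℝ → ℝ) (t : ℝ) : ℝ :=
  (∫ s in Ioi 1, roIntegrand φ s) * φ'' t - secondSolution'' φ φ' φ'' t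

include hφ hpos hint in
/-- `χ′` is the derivative of `χ` on `(0, ∞)`. -/
theorem hasDerivAt_decaySolution {t : ℝ} (ht : 0 < t) :
    HasDerivAt (decaySolution φ) (decaySolution' φ φ' t) t := by
  have h := ((hφ t ht).const_mul (∫ s in Ioi 1, roIntegrand φ s)).sub (hasDerivAt_secondSolution hφ hpos ht)
  refine h.congr_of_eventuallyEq ?_
  filter_upwards [Ioi_mem_nhds ht] with s hs
  exact decaySolution_eq hφ hpos hint hs

include hφ hφ' hpos in
/-- `χ″` is the derivative of `χ′` on `(0, ∞)`. -/
theorem hasDerivAt_decaySolution' {t : ℝ} (ht : 0 < t) :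
    HasDerivAt (decaySolution' φ φ') (decaySolution'' φ φ' φ'' t) t :=
  ((hφ' t ht).const_mul (∫ s in Ioi 1, roIntegrand φ s)).sub (hasDerivAt_secondSolution' hφ hφ' hpos ht)

include hφ hpos hint in
/-- **`χ` solves the radial equation** on `(0, ∞)`. -/
theorem decaySolution_ode
    (hode : ∀ t, 0 < t → Real.sinh (2 * t) * φ'' t + 2 * Real.cosh (2 * t) * φ' t = μ * Real.sinh (2 * t) * φ t)
    {t : ℝ} (ht : 0 < t) :
    Real.sinh (2 * t) * decaySolution'' φ φ' φ'' t + 2 * Real.cosh (2 * t) * decaySolution' φ φ' t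
      = μ * Real.sinh (2 * t) * decaySolution φ t := by
  rw [decaySolution_eq hφ hpos hint ht]
  unfold decaySolution'' decaySolution'
  have e1 := hode t ht
  have e2 := secondSolution_ode hpos hode ht
  linear_combination (∫ s in Ioi 1, roIntegrand φ s) * e1 - e2

include hφ hpos hint in
/-- **The Wronskian** `sinh 2t · (φ χ′ − φ′ χ) = −1` on `(0, ∞)`. -/
theorem wronskian_decaySolution {t : ℝ} (ht : 0 < t) :
    Real.sinh (2 * t) * (φ t * decaySolution' φ φ' t - φ' t * decaySolution φ t) = -1 := by
  rw [decaySolution_eq hφ hpos hint ht]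
  unfold decaySolution'
  have := wronskian_secondSolution (φ' := φ') hpos ht
  linear_combination -this

/-! ### Uniqueness of the decaying solution -/

include hφ hφ' hpos hint in
/-- **A solution with `u/φ → 0` at infinity is a multiple of `χ`**: `u = −sinh 2 · (φ(1) u′(1) − φ′(1) u(1)) · χ`
on `(0, ∞)`. -/
theorem eq_const_mul_decaySolution_of_tendsto
    (hode : ∀ t, 0 < t → Real.sinh (2 * t) * φ'' t + 2 * Real.cosh (2 * t) * φ' t = μ * Real.sinh (2 * t) * φ t)
    {u u' u'' : ℝ → ℝ} (hu : ∀ t, 0 < t → HasDerivAt u (u' t) t) (hu' : ∀ t, 0 < t → HasDerivAt u' (u'' t) t)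
    (huode : ∀ t, 0 < t → Real.sinh (2 * t) * u'' t + 2 * Real.cosh (2 * t) * u' t = μ * Real.sinh (2 * t) * u t)
    (hdecay : Tendsto (fun t => u t / φ t) atTop (𝓝 0)) {t : ℝ} (ht : 0 < t) :
    u t = -(Real.sinh 2 * (φ 1 * u' 1 - φ' 1 * u 1)) * decaySolution φ t := by
  set a := u 1 / φ 1 with ha
  set b := Real.sinh 2 * (φ 1 * u' 1 - φ' 1 * u 1) with hb
  set J := ∫ s in Ioi 1, roIntegrand φ s with hJ
  have hrep : ∀ s, 0 < s → u s = a * φ s + b * secondSolution φ s :=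
    fun s hs => eq_add_of_ode hφ hφ' hpos hode hu hu' huode hs
  -- `u/φ = a + b I → a + b J`
  have hlim : Tendsto (fun s => u s / φ s) atTop (𝓝 (a + b * J)) := by
    have h := (tendsto_const_nhds (x := a)).add ((tendsto_roIntegral_atTop hint).const_mul b)
    refine h.congr' ?_
    filter_upwards [eventually_gt_atTop 0] with s hs
    rw [hrep s hs]
    unfold secondSolution
    field_simp [(hpos s hs).ne']
  have hab : a + b * J = 0 := tendsto_nhds_unique hlim hdecay
  rw [hrep t ht, decaySolution_eq hφ hpos hint ht]
  linear_combination (φ t) * hab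

include hφ hφ' hpos hint in
/-- **THE DECAYING SOLUTION IS UNIQUE UP TO A CONSTANT**: every solution `u` with `u/φ → 0` at infinity is `c χ`. -/
theorem exists_eq_const_mul_decaySolution_of_tendsto
    (hode : ∀ t, 0 < t → Real.sinh (2 * t) * φ'' t + 2 * Real.cosh (2 * t) * φ' t = μ * Real.sinh (2 * t) * φ t)
    {u u' u'' : ℝ → ℝ} (hu : ∀ t, 0 < t → HasDerivAt u (u' t) t) (hu' : ∀ t, 0 < t → HasDerivAt u' (u'' t) t)
    (huode : ∀ t, 0 < t → Real.sinh (2 * t) * u'' t + 2 * Real.cosh (2 * t) * u' t = μ * Real.sinh (2 * t) * u t)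
    (hdecay : Tendsto (fun t => u t / φ t) atTop (𝓝 0)) :
    ∃ c : ℝ, ∀ t, 0 < t → u t = c * decaySolution φ t :=
  ⟨-(Real.sinh 2 * (φ 1 * u' 1 - φ' 1 * u 1)),
    fun _ ht => eq_const_mul_decaySolution_of_tendsto hφ hφ' hpos hint hode hu hu' huode hdecay ht⟩

end

end Summit.Ventures.HodgeRepro2.T5SU11ReductionOfOrderInfinity
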